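import Summits.QuantumFields.BalabanUV.Beta.RemainderExplicitHistoryDiagonalRatePowerProfileTwo

/-!
# RemainderExplicitHistoryDiagonalRatePowerTailOne — ROAD P3, ORDER-0 PROFILE FAMILY: THE HARMONIC TAIL `R(N) − R(k) ≤ T₀∕(k+1)` (`q = 1`)
# — the third file's shapes hold with `A₁ = 4` and `A₂ = 6T₀` (the young half of the convolution is a HARMONIC sum `≤ log`, absorbed by
# `log w ≤ w − 1`), so the rate `√m∕n` in the cutoff is two-sided and pointwise; instance: the first-moment-borderline profile `ρ(a) = M₀∕(a+1)²`
# (fifth file of station S-d4p3-g50-1 — with generation 49's files and this station's third ∕ fourth files, EVERY power tail `0 < q < 2`)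

Cell `pub-balaban`, β-function sub-cell, BINDER row D4 «RemainderConst leaves for Bałaban's split» (`HOME/BINDER-OWNERS.md`; owner
lineage `b2b-balaban-beta-an4`; this file by co-owner #3 lineage `b2b-balaban-beta-d4-p3`, road P3 «the reduction road», generation 50,
station S-d4p3-g50-1, fifth file; imports the station's fourth file `RemainderExplicitHistoryDiagonalRatePowerProfileTwo`), β-FLOW TEAM
duty (1); FREEZE (0) honoured (def-free module in road P3's own `RemainderExplicit*` series; no leaf, no interface, no Literature file).
SOURCE OF THE SHAPES ONLY: [Balaban1987RG1] (0.20) p. 256, (0.31) and Thm 2 p. 259, §5 p. 298.  Pure real analysis about ONE explicit toy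
family (ours, not Bałaban's).

HONEST FRAMING (page 1 of everything the β sub-cell writes).  *"Discharging BetaPertH makes Bałaban's UV stability UNCONDITIONAL — a real
constructive-QFT result; it is NOT the continuum limit and NOT the Clay problem."*  THIS FILE DISCHARGES NOTHING OF THE KIND.  The exponent
`q = 1` sits between generation 49's range `0 < q < 1` (Bernoulli with exponent `q`) and this station's `1 < q < 2` (Bernoulli with exponent
`q − 1`): here (T1) is elementary (`(2k+1)∕(k+2) ≤ 2`, `A₁ = 4`) and in (T2) the young half `Σ_{i≤j₀∕2} 1∕(i+2) ≤ log(j₀∕2 + 2)` is a harmonic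
sum — the logarithm is harmless because the young terms carry `1∕(j₀+2)²` and `log w ≤ w − 1` (`A₂ = 6T₀`, no logarithm in the constant).  With
the fourth file's profile tails at `q = 1` the first-moment-borderline profile `ρ(a) = M₀∕(a+1)²` (road P3's `p = 2`: `Σ_a a·ρ(a)` diverges
logarithmically) reaches its continuum coupling at the two-sided pointwise rate `√m∕n`.  CENSUS for road P3's polynomial profiles `a^{−p}` after
this file: `p ≤ 3∕2` NOT m-uniform (generation 48); `3∕2 < p < 3` two-sided pointwise rate `√m∕n^{p−1}` (generations 49–50); `p ≥ 3` not treated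
((T1) fails).  Nothing of Bałaban's (1.22) is asserted or constructed; row D4 class UNCHANGED (critical-path width 0; instance 0∕1; D4
DISCHARGE NO DATE); NOT B12 Thm 2, NOT BetaPertH, NOT continuum, NOT Clay.  HONEST DEPENDENCY: continuum YM on T⁴ ⇐ BetaPertH ∧ nine spine
estimates (0/9 proved); BetaPertH ⇐ (D1) ∧ (D4) ∧ CAP+tail; G-an2-4 gates asym, D1 and NE2/3/4.  ABSOLUTE RULE: nothing is cited as a fact.

WHAT IS PROVED ([folklore]; 0 sorry; 0 `def`).
* §1 `sum_inv_shift_le_log` (`Σ_{i<N} 1∕(i+2) ≤ log(N+1)`), `sum_inv_sq_shift_le_one` (`Σ_{t<N} 1∕((t+2)(t+2)) ≤ 1`),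
  **`powerTailOne_T1`** (`A₁ = 4`), **`powerTailOne_T2`** (`A₂ = 6T₀`).
* §2 **`powerTailOne_rate`** (`6T₀ ≤ b√b√m`, `m ≤ n+1` ⇒ `astar g m − invSq g m n ≤ Λ₄√m·T₀∕(n+2)`, `Λ₄ = 4∕√b + 32√2κ∕((1−Wγ∕b)√b)`),
  **`powerTailOne_rate_uniform`**, **`powerTailOne_rate_lower_pointwise`** (minorant `T₁∕(k+1)`, `Wγ < b`).
* §3 the profile `ρ(a) = M₀∕(a+1)²`: `powerProfileOne_tail_le` (`≤ 5M₀∕(k+1)`), `powerProfileOne_tail_ge` (`≥ (M₀∕8)∕(k+1)`),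
  **`powerProfileOne_rate`**, **`powerProfileOne_rate_lower_pointwise`**, END **`exists_family_powerProfileOne_rate`** (`10M₀γ ≤ b`).
All letters NOT-IN-PRINT; `BetaFlowAsPrinted S` records a Markov β_n only ⇒ no junction of the as-printed interface changes.
-/

noncomputable section

open Finset Filter Topology

namespace Summit.QuantumFields.BalabanUV.Beta.RemainderExplicitHistoryDiagonalRatePowerTailOne

open Literature.MathematicalPhysics.QuantumFieldTheory.Balaban1983to89
open Literature.MathematicalPhysics.QuantumFieldTheory.Balaban1983to89.FlowStep
open Literature.MathematicalPhysics.QuantumFieldTheory.Balaban1983to89.T4CouplingMatching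
open Literature.MathematicalPhysics.QuantumFieldTheory.Balaban1983to89.T4ContinuumCoupling
open Summit.QuantumFields.BalabanUV.Beta.RemainderExplicitHistoryDiagonalRate
open Summit.QuantumFields.BalabanUV.Beta.RemainderExplicitHistoryDiagonalRatePowerShapes (sum_minSq_le_tails)
open Summit.QuantumFields.BalabanUV.Beta.RemainderExplicitHistoryDiagonalRateUniform
open Summit.QuantumFields.BalabanUV.Beta.RemainderExplicitHistoryDiagonalRatePowerTailTwo (sum_tail_le_one)
open Summit.QuantumFields.BalabanUV.Beta.RemainderExplicitHistoryDiagonalRatePowerProfileTwo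

variable {β : HBeta} {b γ W : ℝ} {ρ : ℕ → ℝ}

/-! ## §1 The two shapes of the third file for the harmonic tail `τ(k) = T₀∕(k+1)` -/

/-- HARMONIC SUM: `Σ_{i<N} 1∕(i+2) ≤ log(N+1)` (`1∕(i+2) = 1 − (i+1)∕(i+2) ≤ log((i+2)∕(i+1))`, Mathlib's `Real.one_sub_inv_le_log_of_pos`,
telescoped). [folklore] -/
theorem sum_inv_shift_le_log (N : ℕ) : ∑ i ∈ range N, 1 / ((i : ℝ) + 2) ≤ Real.log ((N : ℝ) + 1) := by
  have hstep : ∀ i : ℕ, 1 / ((i : ℝ) + 2) ≤ Real.log ((i : ℝ) + 2) - Real.log ((i : ℝ) + 1) := by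
    intro i
    have h1 : (0 : ℝ) < (i : ℝ) + 1 := by positivity
    have h2 : (0 : ℝ) < (i : ℝ) + 2 := by positivity
    have h := Real.one_sub_inv_le_log_of_pos (x := ((i : ℝ) + 2) / ((i : ℝ) + 1)) (by positivity)
    rw [Real.log_div h2.ne' h1.ne', inv_div] at h
    have e : (1 : ℝ) - ((i : ℝ) + 1) / ((i : ℝ) + 2) = 1 / ((i : ℝ) + 2) := by field_simp; ring
    linarith
  calc ∑ i ∈ range N, 1 / ((i : ℝ) + 2) ≤ ∑ i ∈ range N, (Real.log ((i : ℝ) + 2) - Real.log ((i : ℝ) + 1)) :=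
        Finset.sum_le_sum fun i _ => hstep i
    _ = ∑ i ∈ range N, ((fun t : ℕ => Real.log ((t : ℝ) + 1)) (i + 1) - (fun t : ℕ => Real.log ((t : ℝ) + 1)) i) := by
        refine Finset.sum_congr rfl fun i _ => ?_
        push_cast; ring_nf
    _ = Real.log ((N : ℝ) + 1) - Real.log (((0 : ℕ) : ℝ) + 1) := Finset.sum_range_sub (fun t : ℕ => Real.log ((t : ℝ) + 1)) N
    _ = Real.log ((N : ℝ) + 1) := by simp

/-- `Σ_{t<N} 1∕((t+2)(t+2)) ≤ 1` (the third file's `sum_tail_le_one` at exponent `1`). [folklore] -/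
theorem sum_inv_sq_shift_le_one (N : ℕ) : ∑ t ∈ range N, 1 / (((t : ℝ) + 2) * ((t : ℝ) + 2)) ≤ 1 := by
  have h := sum_tail_le_one (q := 1) le_rfl N
  simpa only [Real.rpow_one] using h

/-- SHAPE (T1) WITH `A₁ = 4` for the harmonic tail: if `R(N) − R(k) ≤ T₀∕(k+1)` (`k ≤ N`, `T₀ ≥ 0`), then for `K ≥ 1`
`Σ_{a<N} ρ(a)min(a,K)² ≤ 4·K²·(T₀∕(K+1))` (Abel, then `(2k+1)∕(k+2) ≤ 2` and `K+1 ≤ 2K`). [folklore] -/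
theorem powerTailOne_T1 {ρ : ℕ → ℝ} {T₀ : ℝ} (hT₀ : 0 ≤ T₀)
    (hτ : ∀ k N, k ≤ N → ∑ a ∈ range N, ρ a - ∑ a ∈ range k, ρ a ≤ T₀ / ((k : ℝ) + 1))
    (K N : ℕ) (hK : 1 ≤ K) :
    ∑ a ∈ range N, ρ a * (min (a : ℝ) K) ^ 2 ≤ 4 * (K : ℝ) ^ 2 * (T₀ / ((K : ℝ) + 1)) := by
  have hKr : (1 : ℝ) ≤ K := by exact_mod_cast hK
  have hK1 : (0 : ℝ) < (K : ℝ) + 1 := by linarith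
  have h1 := sum_minSq_le_tails (τ := fun k => T₀ / ((k : ℝ) + 1)) (fun k => by positivity) hτ K N
  refine h1.trans ?_
  have hterm : ∀ k ∈ range K, (2 * (k : ℝ) + 1) * (T₀ / ((((k + 1 : ℕ) : ℝ)) + 1)) ≤ 2 * T₀ := by
    intro k _
    have hx : (0 : ℝ) < (k : ℝ) + 2 := by positivity
    have e : (((k + 1 : ℕ) : ℝ)) + 1 = (k : ℝ) + 2 := by push_cast; ring
    rw [e, mul_div_assoc', div_le_iff₀ hx]
    nlinarith
  calc ∑ k ∈ range K, (2 * (k : ℝ) + 1) * (T₀ / ((((k + 1 : ℕ) : ℝ)) + 1))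
      ≤ ∑ k ∈ range K, 2 * T₀ := sum_le_sum hterm
    _ = 2 * T₀ * (K : ℝ) := by rw [Finset.sum_const, Finset.card_range, nsmul_eq_mul]; ring
    _ ≤ 4 * (K : ℝ) ^ 2 * (T₀ / ((K : ℝ) + 1)) := by
        rw [show 4 * (K : ℝ) ^ 2 * (T₀ / ((K : ℝ) + 1)) = (2 * T₀ * K) * (2 * K / ((K : ℝ) + 1)) by ring]
        have h2 : 1 ≤ 2 * (K : ℝ) / ((K : ℝ) + 1) := by rw [le_div_iff₀ hK1]; linarith
        have h0 : 0 ≤ 2 * T₀ * (K : ℝ) := by positivity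
        nlinarith

/-- SHAPE (T2) WITH `A₂ = 6T₀` for the harmonic tail `τ(k) = T₀∕(k+1)`:
`Σ_{i<j₀} τ(i+1)τ(j₀−i)∕(j₀+1−i) ≤ 6T₀·τ(j₀+1)` — split at `j₀∕2`: the young half carries `1∕(j₀+2)²` times the harmonic sum
`Σ_{i≤j₀∕2} 1∕(i+2) ≤ log(j₀+2) ≤ j₀ + 1`, the old half `2∕(j₀+2)` times `Σ 1∕(t+2)² ≤ 1`. [folklore] -/
theorem powerTailOne_T2 {T₀ : ℝ} (j₀ : ℕ) :
    ∑ i ∈ range j₀, (T₀ / ((((i + 1 : ℕ) : ℝ)) + 1)) * (T₀ / ((((j₀ - i : ℕ) : ℝ)) + 1)) / ((j₀ + 1 - i : ℕ) : ℝ)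
      ≤ 6 * T₀ * (T₀ / ((((j₀ + 1 : ℕ) : ℝ)) + 1)) := by
  set h : ℕ := j₀ / 2 with hh
  set w : ℝ := (j₀ : ℝ) + 2 with hw
  have hw0 : 0 < w := by rw [hw]; positivity
  have hw2 : (2 : ℝ) ≤ w := by rw [hw]; have : (0 : ℝ) ≤ j₀ := Nat.cast_nonneg _; linarith
  have ej : (((j₀ + 1 : ℕ) : ℝ)) + 1 = w := by rw [hw]; push_cast; ring
  rw [ej]
  set cA : ℝ := T₀ ^ 2 * (4 / (w * w)) with hcA
  set cB : ℝ := T₀ ^ 2 * (2 / w) with hcB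
  have hcA0 : 0 ≤ cA := by positivity
  have hcB0 : 0 ≤ cB := by positivity
  set fA : ℕ → ℝ := fun i => if i ≤ h then cA * (1 / ((i : ℝ) + 2)) else 0 with hfA
  set fB : ℕ → ℝ := fun i => cB * (1 / ((((j₀ + 1 - i : ℕ) : ℝ)) * ((j₀ + 1 - i : ℕ) : ℝ))) with hfB
  have hterm : ∀ i ∈ range j₀, (T₀ / ((((i + 1 : ℕ) : ℝ)) + 1)) * (T₀ / ((((j₀ - i : ℕ) : ℝ)) + 1)) / ((j₀ + 1 - i : ℕ) : ℝ)
        ≤ fA i + fB i := by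
    intro i hi
    have hi' := Finset.mem_range.mp hi
    have ei : (((i + 1 : ℕ) : ℝ)) + 1 = (i : ℝ) + 2 := by push_cast; ring
    have ev : (((j₀ - i : ℕ) : ℝ)) + 1 = ((j₀ + 1 - i : ℕ) : ℝ) := by
      rw [show j₀ + 1 - i = (j₀ - i) + 1 by omega]; push_cast; ring
    rw [ei, ev]
    set v : ℝ := ((j₀ + 1 - i : ℕ) : ℝ) with hv
    have hv0 : (0 : ℝ) < v := by rw [hv]; exact_mod_cast (by omega : 0 < j₀ + 1 - i)
    have hx : (0 : ℝ) < (i : ℝ) + 2 := by positivity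
    have eterm : (T₀ / ((i : ℝ) + 2)) * (T₀ / v) / v = T₀ ^ 2 * (1 / ((i : ℝ) + 2)) * (1 / (v * v)) := by
      field_simp
    rw [eterm]
    have hfA0 : 0 ≤ fA i := by simp only [hfA]; split_ifs <;> positivity
    have hfB0 : 0 ≤ fB i := by simp only [hfB]; positivity
    by_cases hih : i ≤ h
    · -- young: `v ≥ w∕2`, so `1∕(v·v) ≤ 4∕(w·w)`
      have hvw : w / 2 ≤ v := by
        rw [hw, hv]
        have : (j₀ : ℝ) + 2 ≤ 2 * ((j₀ + 1 - i : ℕ) : ℝ) := by exact_mod_cast (by omega : j₀ + 2 ≤ 2 * (j₀ + 1 - i))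
        linarith
      have hA1 : 1 / (v * v) ≤ 4 / (w * w) := by
        rw [div_le_div_iff₀ (by positivity) (by positivity)]
        nlinarith [hvw, hv0, hw0]
      calc T₀ ^ 2 * (1 / ((i : ℝ) + 2)) * (1 / (v * v))
          ≤ T₀ ^ 2 * (1 / ((i : ℝ) + 2)) * (4 / (w * w)) := mul_le_mul_of_nonneg_left hA1 (by positivity)
        _ = fA i := by simp only [hfA, if_pos hih, hcA]; ring
        _ ≤ fA i + fB i := by linarith
    · -- old: `i + 2 ≥ w∕2`, so `1∕(i+2) ≤ 2∕w`
      rw [not_le] at hih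
      have hiw : w / 2 ≤ (i : ℝ) + 2 := by
        rw [hw]
        have : (j₀ : ℝ) < 2 * ((i : ℝ) + 1) := by exact_mod_cast (by omega : j₀ < 2 * (i + 1))
        linarith
      have hB1 : 1 / ((i : ℝ) + 2) ≤ 2 / w := by
        rw [div_le_div_iff₀ hx hw0]; linarith
      calc T₀ ^ 2 * (1 / ((i : ℝ) + 2)) * (1 / (v * v))
          ≤ T₀ ^ 2 * (2 / w) * (1 / (v * v)) :=
            mul_le_mul_of_nonneg_right (mul_le_mul_of_nonneg_left hB1 (by positivity)) (by positivity)
        _ = fB i := by simp only [hfB, hcB, hv]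
        _ ≤ fA i + fB i := by linarith
  -- the young half: a harmonic sum, absorbed by `log w ≤ w − 1`
  have hA : ∑ i ∈ range j₀, fA i ≤ cA * (w - 1) := by
    have hsub : ∑ i ∈ range j₀, fA i ≤ ∑ i ∈ range (h + 1), cA * (1 / ((i : ℝ) + 2)) := by
      calc ∑ i ∈ range j₀, fA i = ∑ i ∈ (range j₀).filter (fun i => i ≤ h), cA * (1 / ((i : ℝ) + 2)) := by
            rw [Finset.sum_filter]
        _ ≤ ∑ i ∈ range (h + 1), cA * (1 / ((i : ℝ) + 2)) := by
            refine Finset.sum_le_sum_of_subset_of_nonneg ?_ fun i _ _ => by positivity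
            intro i hi
            have := (Finset.mem_filter.mp hi).2
            exact Finset.mem_range.mpr (by omega)
    have hharm := sum_inv_shift_le_log (h + 1)
    have hlog : Real.log ((((h + 1 : ℕ) : ℝ)) + 1) ≤ w - 1 := by
      have hpos : (0 : ℝ) < (((h + 1 : ℕ) : ℝ)) + 1 := by positivity
      have h1 := Real.log_le_sub_one_of_pos hpos
      have h2 : (((h + 1 : ℕ) : ℝ)) + 1 ≤ w := by rw [hw]; exact_mod_cast (by omega : h + 1 + 1 ≤ j₀ + 2)
      linarith
    calc ∑ i ∈ range j₀, fA i ≤ ∑ i ∈ range (h + 1), cA * (1 / ((i : ℝ) + 2)) := hsub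
      _ = cA * ∑ i ∈ range (h + 1), 1 / ((i : ℝ) + 2) := by rw [Finset.mul_sum]
      _ ≤ cA * (w - 1) := mul_le_mul_of_nonneg_left (hharm.trans hlog) hcA0
  -- the old half against `Σ 1∕(t+2)² ≤ 1`, reflected
  have hB : ∑ i ∈ range j₀, fB i ≤ cB * 1 := by
    have hrefl : ∑ i ∈ range j₀, 1 / ((((j₀ + 1 - i : ℕ) : ℝ)) * ((j₀ + 1 - i : ℕ) : ℝ))
        = ∑ t ∈ range j₀, 1 / (((t : ℝ) + 2) * ((t : ℝ) + 2)) := by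
      rw [← Finset.sum_range_reflect (fun t : ℕ => 1 / (((t : ℝ) + 2) * ((t : ℝ) + 2))) j₀]
      refine Finset.sum_congr rfl fun i hi => ?_
      have hi' := Finset.mem_range.mp hi
      have e : ((j₀ + 1 - i : ℕ) : ℝ) = ((j₀ - 1 - i : ℕ) : ℝ) + 2 := by
        rw [show j₀ + 1 - i = (j₀ - 1 - i) + 2 by omega]; push_cast; ring
      rw [e]
    calc ∑ i ∈ range j₀, fB i = cB * ∑ i ∈ range j₀, 1 / ((((j₀ + 1 - i : ℕ) : ℝ)) * ((j₀ + 1 - i : ℕ) : ℝ)) := by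
          rw [Finset.mul_sum]
      _ ≤ cB * 1 := by rw [hrefl]; exact mul_le_mul_of_nonneg_left (sum_inv_sq_shift_le_one j₀) hcB0
  have hsum2 : ∑ i ∈ range j₀, (fA i + fB i) ≤ cA * (w - 1) + cB * 1 := by
    rw [Finset.sum_add_distrib]; exact add_le_add hA hB
  refine ((Finset.sum_le_sum hterm).trans hsum2).trans ?_
  -- algebra: `cA·(w−1) ≤ 4T₀²∕w` and `cB = 2T₀²∕w`
  have e1 : cA * (w - 1) = (4 * T₀ ^ 2 / w) * ((w - 1) / w) := by simp only [hcA]; field_simp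
  have e2 : cB * 1 = 2 * T₀ ^ 2 / w := by simp only [hcB]; ring
  have h3 : (4 * T₀ ^ 2 / w) * ((w - 1) / w) ≤ (4 * T₀ ^ 2 / w) * 1 :=
    mul_le_mul_of_nonneg_left (by rw [div_le_one hw0]; linarith) (by positivity)
  rw [e1, e2]
  calc 4 * T₀ ^ 2 / w * ((w - 1) / w) + 2 * T₀ ^ 2 / w ≤ 4 * T₀ ^ 2 / w * 1 + 2 * T₀ ^ 2 / w := by linarith
    _ = 6 * T₀ * (T₀ / w) := by field_simp; ring

/-! ## §2 The rate for the harmonic tail -/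

/-- **ROAD P3 — THE RATE IN THE CUTOFF FOR THE HARMONIC TAIL `R(N) − R(k) ≤ T₀∕(k+1)`.**  A pinned family of runs of the order-0 profile family
in ]0,γ] (`b > 0`, `γ > 0`, `ρ ≥ 0`, `Σ_{a<N} ρ_a ≤ W`, `Wγ < b`), tail majorant `T₀∕(k+1)` (`T₀ ≥ 0`); for every `m` with `6T₀ ≤ b√b·√m` and every
`n ≥ m − 1`: `0 ≤ astar g m − invSq g m n ≤ Λ₄·√m·T₀∕(n+2)`, `Λ₄ = 4∕√b + 32√2κ∕((1−Wγ∕b)√b)`. [cite: Balaban1987RG1, (0.20) p.256, (0.31) and Thm 2 p.259] -/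
theorem powerTailOne_rate {T₀ : ℝ}
    (hβ : ∀ (k : ℕ) (p : Fin (k + 1) → ℝ),
      β k p = b + ∑ i : Fin (k + 1), ρ (k - i) * min (p (Fin.last k)) (|p (Fin.last k) - p i|))
    (hb : 0 < b) (hγ : 0 < γ) (hρ0 : ∀ a, 0 ≤ ρ a) (hρW : ∀ n, ∑ a ∈ range n, ρ a ≤ W) (hsmall : W * γ < b) (hT₀ : 0 ≤ T₀)
    (hτ : ∀ k N : ℕ, k ≤ N → ∑ a ∈ range N, ρ a - ∑ a ∈ range k, ρ a ≤ T₀ / ((k : ℝ) + 1))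
    {g : ℕ → ℕ → ℝ} {gIR : ℝ} (hrun : ∀ K, RGEqH K β (g K)) (hbox : ∀ K i, i ≤ K → 0 < g K i ∧ g K i ≤ γ)
    (hpin : ∀ K, g K K = gIR) {m n : ℕ} (hm : 6 * T₀ ≤ b * Real.sqrt b * Real.sqrt (m : ℝ)) (hmn : m ≤ n + 1) :
    0 ≤ astar g m - invSq g m n ∧ astar g m - invSq g m n
      ≤ (4 / Real.sqrt b + 8 * Real.sqrt 2 * ((b + W * γ) / b) * 4 / ((1 - W * γ / b) * Real.sqrt b))
        * Real.sqrt (m : ℝ) * (T₀ / ((((n + 1 : ℕ) : ℝ)) + 1)) := by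
  have hτmono : ∀ k l : ℕ, k ≤ l → T₀ / ((l : ℝ) + 1) ≤ T₀ / ((k : ℝ) + 1) := fun k l hkl =>
    div_le_div_of_nonneg_left hT₀ (by positivity) (by exact_mod_cast Nat.add_le_add_right hkl 1)
  exact astar_sub_invSq_le_rate (τ := fun k => T₀ / ((k : ℝ) + 1)) (A₁ := 4) (A₂ := 6 * T₀)
    hβ hb hγ hρ0 hρW hsmall (fun k => by positivity) hτmono hτ (by norm_num)
    (fun K N hK => powerTailOne_T1 hT₀ hτ K N hK) (fun j₀ => powerTailOne_T2 j₀) hrun hbox hpin hm hmn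

/-- **THE SAME BELOW THE THRESHOLD, ONE CONSTANT** (second file): threshold `6T₀ ≤ b√b·√σ₀`; for `m ≤ σ₀`, `2σ₀ ≤ n+m+1`:
`astar g m − invSq g m n ≤ Λ₄√σ₀·T₀∕(n+m+2−σ₀) ∕ (1 − Wγ∕b)`. [cite: Balaban1987RG1, (0.20) p.256, (0.31) and Thm 2 p.259] -/
theorem powerTailOne_rate_uniform {T₀ : ℝ}
    (hβ : ∀ (k : ℕ) (p : Fin (k + 1) → ℝ),
      β k p = b + ∑ i : Fin (k + 1), ρ (k - i) * min (p (Fin.last k)) (|p (Fin.last k) - p i|))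
    (hb : 0 < b) (hγ : 0 < γ) (hρ0 : ∀ a, 0 ≤ ρ a) (hρW : ∀ n, ∑ a ∈ range n, ρ a ≤ W) (hsmall : W * γ < b) (hT₀ : 0 ≤ T₀)
    (hτ : ∀ k N : ℕ, k ≤ N → ∑ a ∈ range N, ρ a - ∑ a ∈ range k, ρ a ≤ T₀ / ((k : ℝ) + 1))
    {g : ℕ → ℕ → ℝ} {gIR : ℝ} (hrun : ∀ K, RGEqH K β (g K)) (hbox : ∀ K i, i ≤ K → 0 < g K i ∧ g K i ≤ γ)
    (hpin : ∀ K, g K K = gIR) {σ₀ m n : ℕ} (hσ₀ : 6 * T₀ ≤ b * Real.sqrt b * Real.sqrt (σ₀ : ℝ)) (hm : m ≤ σ₀)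
    (hn : 2 * σ₀ ≤ n + m + 1) :
    0 ≤ astar g m - invSq g m n ∧ astar g m - invSq g m n
      ≤ (4 / Real.sqrt b + 8 * Real.sqrt 2 * ((b + W * γ) / b) * 4 / ((1 - W * γ / b) * Real.sqrt b))
          * Real.sqrt (σ₀ : ℝ) * (T₀ / ((((n + m + 1 - σ₀ : ℕ) : ℝ)) + 1)) / (1 - W * γ / b) := by
  have hτmono : ∀ k l : ℕ, k ≤ l → T₀ / ((l : ℝ) + 1) ≤ T₀ / ((k : ℝ) + 1) := fun k l hkl =>
    div_le_div_of_nonneg_left hT₀ (by positivity) (by exact_mod_cast Nat.add_le_add_right hkl 1)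
  exact astar_sub_invSq_le_rate_uniform (τ := fun k => T₀ / ((k : ℝ) + 1)) (A₁ := 4) (A₂ := 6 * T₀)
    hβ hb hγ hρ0 hρW hsmall (fun k => by positivity) hτmono hτ (by norm_num)
    (fun K N hK => powerTailOne_T1 hT₀ hτ K N hK) (fun j₀ => powerTailOne_T2 j₀) hrun hbox hpin hσ₀ hm hn

/-- **THE HARMONIC MINORANT, LOWER SIDE POINTWISE**: `T₁∕(k+1) ≤ Σ_{a∈[k,N)} ρ_a` for `k ≥ 1`, `N ≥ 2k` (`T₁ ≥ 0`), `Wγ < b`; for `1 ≤ m ≤ n+1`: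
`√m·T₁∕(n+m+1) ≤ 8κ₂√b₂(1+Wγ∕b)·(astar g m − invSq g m n)∕(1 − Wγ∕b)`. [cite: Balaban1987RG1, (0.20) p.256, (0.31) and Thm 2 p.259] -/
theorem powerTailOne_rate_lower_pointwise {T₁ : ℝ}
    (hβ : ∀ (k : ℕ) (p : Fin (k + 1) → ℝ),
      β k p = b + ∑ i : Fin (k + 1), ρ (k - i) * min (p (Fin.last k)) (|p (Fin.last k) - p i|))
    (hb : 0 < b) (hγ : 0 < γ) (hρ0 : ∀ a, 0 ≤ ρ a) (hρW : ∀ n, ∑ a ∈ range n, ρ a ≤ W) (hsmall : W * γ < b) (hT₁ : 0 ≤ T₁)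
    (hτ' : ∀ k N : ℕ, 1 ≤ k → 2 * k ≤ N → T₁ / ((k : ℝ) + 1) ≤ ∑ a ∈ range N, ρ a - ∑ a ∈ range k, ρ a)
    {g : ℕ → ℕ → ℝ} {gIR : ℝ} (hrun : ∀ K, RGEqH K β (g K)) (hbox : ∀ K i, i ≤ K → 0 < g K i ∧ g K i ≤ γ)
    (hpin : ∀ K, g K K = gIR) {m n : ℕ} (hm : 1 ≤ m) (hmn : m ≤ n + 1) :
    Real.sqrt (m : ℝ) * (T₁ / ((((n + m : ℕ) : ℝ)) + 1))
      ≤ 8 * ((1 / gIR ^ 2 + (b + W * γ)) / b) * Real.sqrt (1 / gIR ^ 2 + (b + W * γ)) * (1 + W * γ / b)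
          * ((astar g m - invSq g m n) / (1 - W * γ / b)) := by
  have hτ'mono : ∀ k l : ℕ, k ≤ l → T₁ / ((l : ℝ) + 1) ≤ T₁ / ((k : ℝ) + 1) := fun k l hkl =>
    div_le_div_of_nonneg_left hT₁ (by positivity) (by exact_mod_cast Nat.add_le_add_right hkl 1)
  exact astar_sub_invSq_rate_lower_pointwise (τ' := fun k => T₁ / ((k : ℝ) + 1)) hβ hb hγ hρ0 hρW hsmall hτ'mono hτ'
    hrun hbox hpin hm hmn

/-! ## §3 The first-moment-borderline profile `ρ(a) = M₀∕(a+1)²` -/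

/-- The profile `M₀∕(a+1)²` in the fourth file's form at exponent `1`: `M₀∕(a+1)² = M₀∕((a+1)^1·(a+1))`. [folklore] -/
theorem profileOne_rpow_form {M₀ : ℝ} (hρ : ∀ a, ρ a = M₀ / ((a : ℝ) + 1) ^ 2) :
    ∀ a, ρ a = M₀ / ((((a : ℝ) + 1) ^ (1 : ℝ)) * ((a : ℝ) + 1)) := fun a => by
  rw [hρ a, Real.rpow_one, sq]

/-- Tails of `ρ(a) = M₀∕(a+1)²` from above: `Σ_{a<N} ρ(a) − Σ_{a<k} ρ(a) ≤ 5M₀∕(k+1)` (fourth file at `q = 1`). [folklore] -/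
theorem powerProfileOne_tail_le {M₀ : ℝ} (hM₀ : 0 ≤ M₀) (hρ : ∀ a, ρ a = M₀ / ((a : ℝ) + 1) ^ 2) {k N : ℕ} (hkN : k ≤ N) :
    ∑ a ∈ range N, ρ a - ∑ a ∈ range k, ρ a ≤ 5 * M₀ / ((k : ℝ) + 1) := by
  have h := powerProfileTwo_tail_le (q := 1) hM₀ le_rfl (by norm_num) (profileOne_rpow_form hρ) hkN
  rw [Real.rpow_one] at h
  have e : M₀ * (1 + 4 / 1) = 5 * M₀ := by ring
  rwa [e] at h

/-- Tails of `ρ(a) = M₀∕(a+1)²` from below: `k ≥ 1`, `N ≥ 2k` ⇒ `(M₀∕8)∕(k+1) ≤ Σ_{a<N} ρ(a) − Σ_{a<k} ρ(a)` (fourth file at `q = 1`). [folklore] -/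
theorem powerProfileOne_tail_ge {M₀ : ℝ} (hM₀ : 0 ≤ M₀) (hρ : ∀ a, ρ a = M₀ / ((a : ℝ) + 1) ^ 2) {k N : ℕ} (hk : 1 ≤ k)
    (hkN : 2 * k ≤ N) : M₀ / 8 / ((k : ℝ) + 1) ≤ ∑ a ∈ range N, ρ a - ∑ a ∈ range k, ρ a := by
  have h := powerProfileTwo_tail_ge (q := 1) hM₀ zero_le_one (by norm_num) (profileOne_rpow_form hρ) hk hkN
  rwa [Real.rpow_one] at h

/-- Partial sums of `ρ(a) = M₀∕(a+1)²`: `Σ_{a<N} ρ_a ≤ 5M₀`. [folklore] -/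
theorem powerProfileOne_sum_le {M₀ : ℝ} (hM₀ : 0 ≤ M₀) (hρ : ∀ a, ρ a = M₀ / ((a : ℝ) + 1) ^ 2) (N : ℕ) :
    ∑ a ∈ range N, ρ a ≤ 5 * M₀ := by
  have h := powerProfileOne_tail_le hM₀ hρ (Nat.zero_le N)
  simpa using h

/-- **ROAD P3 — THE RATE IN THE CUTOFF FOR `ρ(a) = M₀∕(a+1)²`, UPPER SIDE**: pinned family in ]0,γ], `Σ_{a<N} ρ_a ≤ W`, `Wγ < b`; for every `m`
with `30M₀ ≤ b√b·√m` and `n ≥ m − 1`: `0 ≤ astar g m − invSq g m n ≤ Λ₄·√m·5M₀∕(n+2)`. [cite: Balaban1987RG1, (0.20) p.256, (0.31) and Thm 2 p.259] -/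
theorem powerProfileOne_rate {M₀ : ℝ}
    (hβ : ∀ (k : ℕ) (p : Fin (k + 1) → ℝ),
      β k p = b + ∑ i : Fin (k + 1), ρ (k - i) * min (p (Fin.last k)) (|p (Fin.last k) - p i|))
    (hb : 0 < b) (hγ : 0 < γ) (hM₀ : 0 < M₀) (hρ : ∀ a, ρ a = M₀ / ((a : ℝ) + 1) ^ 2)
    (hρW : ∀ n, ∑ a ∈ range n, ρ a ≤ W) (hsmall : W * γ < b)
    {g : ℕ → ℕ → ℝ} {gIR : ℝ} (hrun : ∀ K, RGEqH K β (g K)) (hbox : ∀ K i, i ≤ K → 0 < g K i ∧ g K i ≤ γ)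
    (hpin : ∀ K, g K K = gIR) {m n : ℕ} (hm : 30 * M₀ ≤ b * Real.sqrt b * Real.sqrt (m : ℝ)) (hmn : m ≤ n + 1) :
    0 ≤ astar g m - invSq g m n ∧ astar g m - invSq g m n
      ≤ (4 / Real.sqrt b + 8 * Real.sqrt 2 * ((b + W * γ) / b) * 4 / ((1 - W * γ / b) * Real.sqrt b))
        * Real.sqrt (m : ℝ) * (5 * M₀ / ((((n + 1 : ℕ) : ℝ)) + 1)) := by
  have hρ0 : ∀ a, 0 ≤ ρ a := fun a => by rw [hρ a]; positivity
  exact powerTailOne_rate hβ hb hγ hρ0 hρW hsmall (by positivity : 0 ≤ 5 * M₀)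
    (fun k N hkN => powerProfileOne_tail_le hM₀.le hρ hkN) hrun hbox hpin (by linarith) hmn

/-- **THE SAME PROFILE, LOWER SIDE POINTWISE** (`Wγ < b`): for `1 ≤ m ≤ n+1`,
`√m·(M₀∕8)∕(n+m+1) ≤ 8κ₂√b₂(1+Wγ∕b)·(astar g m − invSq g m n)∕(1 − Wγ∕b)` — with `powerProfileOne_rate`: the two-sided pointwise rate `√m∕n`
for road P3's `p = 2` profile. [cite: Balaban1987RG1, (0.20) p.256, (0.31) and Thm 2 p.259] -/
theorem powerProfileOne_rate_lower_pointwise {M₀ : ℝ}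
    (hβ : ∀ (k : ℕ) (p : Fin (k + 1) → ℝ),
      β k p = b + ∑ i : Fin (k + 1), ρ (k - i) * min (p (Fin.last k)) (|p (Fin.last k) - p i|))
    (hb : 0 < b) (hγ : 0 < γ) (hM₀ : 0 < M₀) (hρ : ∀ a, ρ a = M₀ / ((a : ℝ) + 1) ^ 2)
    (hρW : ∀ n, ∑ a ∈ range n, ρ a ≤ W) (hsmall : W * γ < b)
    {g : ℕ → ℕ → ℝ} {gIR : ℝ} (hrun : ∀ K, RGEqH K β (g K)) (hbox : ∀ K i, i ≤ K → 0 < g K i ∧ g K i ≤ γ)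
    (hpin : ∀ K, g K K = gIR) {m n : ℕ} (hm : 1 ≤ m) (hmn : m ≤ n + 1) :
    Real.sqrt (m : ℝ) * (M₀ / 8 / ((((n + m : ℕ) : ℝ)) + 1))
      ≤ 8 * ((1 / gIR ^ 2 + (b + W * γ)) / b) * Real.sqrt (1 / gIR ^ 2 + (b + W * γ)) * (1 + W * γ / b)
          * ((astar g m - invSq g m n) / (1 - W * γ / b)) := by
  have hρ0 : ∀ a, 0 ≤ ρ a := fun a => by rw [hρ a]; positivity
  exact powerTailOne_rate_lower_pointwise hβ hb hγ hρ0 hρW hsmall (by positivity : 0 ≤ M₀ / 8)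
    (fun k N hk hkN => powerProfileOne_tail_ge hM₀.le hρ hk hkN) hrun hbox hpin hm hmn

/-- **END — A `p = 2` POWER-PROFILE FAMILY WITH ITS RATE TWO-SIDED AT EVERY INFRARED DISTANCE.**  For `ρ(a) = M₀∕(a+1)²` (`M₀ > 0`), `b > 0`,
`γ > 0` with `10M₀γ ≤ b` (`W = 5M₀`, so `2Wγ ≤ b`), `g_IR ∈ ]0,γ]`: there is a pinned family of runs of the order-0 profile family such that AT
EVERY infrared distance `m` with `30M₀ ≤ b√b√m` and every cutoff `n ≥ m − 1`, BOTH `astar g m − invSq g m n ≤ Λ₄·√m·5M₀∕(n+2)` AND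
`√m·(M₀∕8)∕(n+m+1) ≤ 8κ₂√b₂(1+Wγ∕b)·(astar g m − invSq g m n)∕(1 − Wγ∕b)`. [cite: Balaban1987RG1, (0.20) p.256, (0.31) and Thm 2 p.259] -/
theorem exists_family_powerProfileOne_rate {M₀ b γ gIR : ℝ} (hM₀ : 0 < M₀) (hρ : ∀ a, ρ a = M₀ / ((a : ℝ) + 1) ^ 2)
    (hb : 0 < b) (hγ : 0 < γ) (hsmall : 10 * M₀ * γ ≤ b) (hgIR : 0 < gIR) (hgIRγ : gIR ≤ γ) :
    ∃ (β : HBeta) (g : ℕ → ℕ → ℝ),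
      (∀ (k : ℕ) (p : Fin (k + 1) → ℝ),
          β k p = b + ∑ i : Fin (k + 1), ρ (k - i) * min (p (Fin.last k)) (|p (Fin.last k) - p i|))
      ∧ (∀ K, RGEqH K β (g K)) ∧ (∀ K i, i ≤ K → 0 < g K i ∧ g K i ≤ γ) ∧ (∀ K, g K K = gIR)
      ∧ (∀ m n : ℕ, 30 * M₀ ≤ b * Real.sqrt b * Real.sqrt (m : ℝ) → m ≤ n + 1 →
          astar g m - invSq g m n
            ≤ (4 / Real.sqrt b + 8 * Real.sqrt 2 * ((b + 5 * M₀ * γ) / b) * 4 / ((1 - 5 * M₀ * γ / b) * Real.sqrt b))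
              * Real.sqrt (m : ℝ) * (5 * M₀ / ((((n + 1 : ℕ) : ℝ)) + 1))
          ∧ Real.sqrt (m : ℝ) * (M₀ / 8 / ((((n + m : ℕ) : ℝ)) + 1))
            ≤ 8 * ((1 / gIR ^ 2 + (b + 5 * M₀ * γ)) / b) * Real.sqrt (1 / gIR ^ 2 + (b + 5 * M₀ * γ)) * (1 + 5 * M₀ * γ / b)
              * ((astar g m - invSq g m n) / (1 - 5 * M₀ * γ / b))) := by
  let β : HBeta := fun k p => b + ∑ i : Fin (k + 1), ρ (k - i) * min (p (Fin.last k)) (|p (Fin.last k) - p i|)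
  have hβ : ∀ (k : ℕ) (p : Fin (k + 1) → ℝ),
      β k p = b + ∑ i : Fin (k + 1), ρ (k - i) * min (p (Fin.last k)) (|p (Fin.last k) - p i|) := fun k p => rfl
  have hρ0 : ∀ a, 0 ≤ ρ a := fun a => by rw [hρ a]; positivity
  have hρW := powerProfileOne_sum_le hM₀.le hρ
  have hsmall' : (5 * M₀) * γ < b := by nlinarith [mul_pos hM₀ hγ]
  obtain ⟨g, hrun, hbox, hpin⟩ :=
    RemainderExplicitHistoryDiagonalProfile.runFamily_exists (W := 5 * M₀) hβ hb hγ hρ0 hρW (by nlinarith [mul_pos hM₀ hγ]) hgIR hgIRγ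
  refine ⟨β, g, hβ, hrun, hbox, hpin, fun m n hm hmn => ⟨?_, ?_⟩⟩
  · exact (powerProfileOne_rate hβ hb hγ hM₀ hρ hρW hsmall' hrun hbox hpin hm hmn).2
  · have hm1 : 1 ≤ m := by
      by_contra h0
      have hm0 : m = 0 := by omega
      rw [hm0, Nat.cast_zero, Real.sqrt_zero, mul_zero] at hm
      linarith
    exact powerProfileOne_rate_lower_pointwise hβ hb hγ hM₀ hρ hρW hsmall' hrun hbox hpin hm1 hmn

end Summit.QuantumFields.BalabanUV.Beta.RemainderExplicitHistoryDiagonalRatePowerTailOne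

end
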